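import Literature.Probability.Percolation.SelfRefinementMeasure
import Literature.Probability.Percolation.KohlerSchindlerTassionRSW

/-!
# Finite-size criteria for `M_k`, part 1: boxes, crossing events and lattice walks

Support file for item `stmt-CriticalPhenomena-10267` (route `CardySelfRefinement`, crux
`CriticalPathRSW`, line finite-size-envelope, stub `stub_finiteSizeCriteria`): the finite-size
criteria (H. Kesten, *Percolation theory for mathematicians* (1982), Ch. 5, Thm. 5.1; G. Grimmett,
*Percolation* (1999), §11.7) for the `k`-dependent self-refinement laws `M_k(ρ, c)` and their duals.

This part is deterministic (path-wise) geometry of bond configurations on `ℤ² = Site 2`.  The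
events of the argument are local notations for explicit instances of the tree's `openCrossing`
(see below): rectangles `rect[a, b, lo, hi] = [a, b] × [lo, hi]`, their horizontal / vertical
open crossings `hCross[…]`, `vCross[…]`, and the **annulus event** `annulusCross[c, N, R]` = "an
open path inside the box `c + [-R, R]²` joins the box `c + [-N, N]²` to the boundary of
`c + [-R, R]²`".  We prove, for lattice configurations (`ω ⊆ E(ℤ²)`):

* the identification of the tree's `KST2023.crossing`, `lrCrossing`, `dualTBCrossing` with
  `hCross` / `vCross`;
* first / last exit decompositions of lattice walks (`exists_first_sat`, `exists_last_sat`,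
  `exists_head_walk`, `exists_tail_walk`);
* `mem_annulusCross_of_walk`: an open walk from `c + [-N, N]²` reaching sup-distance `≥ R` from
  `c` produces the annulus event (stop at the first exit), and the monotonicity of the annulus
  event in the outer radius.

No measure theory here.
-/

noncomputable section

namespace Summit.CriticalPhenomena.CardyFormulaZ2.Cruxes.CriticalPathRSW.FiniteSizeEnvelope

open Set
open Literature.Probability.LatticeModels Literature.Probability.Percolation

namespace FSC

/-! ### Rectangles and crossing events (local notations)

To keep these support files free of new definitions, the four events of the argument are local
notations for explicit instances of the tree's `openCrossing S A B`:

* `rect[a, b, lo, hi]` — the lattice rectangle `[a, b] × [lo, hi] ∩ ℤ²` (a `Finset`, Mathlib's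
  order interval of `Site 2 = Fin 2 → ℤ`);
* `hCross[a, b, lo, hi]` — its **horizontal open crossing**: an open path inside the rectangle from
  the left side `{x₀ = a}` to the right side `{x₀ = b}`;
* `vCross[a, b, lo, hi]` — its **vertical open crossing**, from `{x₁ = lo}` to `{x₁ = hi}`;
* `annulusCross[c, N, R]` — the **annulus event** `A(c; N, R)` of Kesten (1982), Ch. 5: an open
  path inside the box `c + [-R, R]²` from the box `c + [-N, N]²` to the boundary of `c + [-R, R]²`. -/

local notation3 "rect[" a ", " b ", " lo ", " hi "]" =>
  (Finset.Icc ![(a : ℤ), (lo : ℤ)] ![(b : ℤ), (hi : ℤ)] : Finset (Site 2))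

local notation3 "hCross[" a ", " b ", " lo ", " hi "]" =>
  (openCrossing (↑(Finset.Icc ![(a : ℤ), (lo : ℤ)] ![(b : ℤ), (hi : ℤ)] : Finset (Site 2)) : Set (Site 2))
    {x : Site 2 | x ∈ (Finset.Icc ![(a : ℤ), (lo : ℤ)] ![(b : ℤ), (hi : ℤ)] : Finset (Site 2)) ∧ x 0 = (a : ℤ)}
    {x : Site 2 | x ∈ (Finset.Icc ![(a : ℤ), (lo : ℤ)] ![(b : ℤ), (hi : ℤ)] : Finset (Site 2)) ∧ x 0 = (b : ℤ)} :
    Set (BondConfig (Site 2)))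

local notation3 "vCross[" a ", " b ", " lo ", " hi "]" =>
  (openCrossing (↑(Finset.Icc ![(a : ℤ), (lo : ℤ)] ![(b : ℤ), (hi : ℤ)] : Finset (Site 2)) : Set (Site 2))
    {x : Site 2 | x ∈ (Finset.Icc ![(a : ℤ), (lo : ℤ)] ![(b : ℤ), (hi : ℤ)] : Finset (Site 2)) ∧ x 1 = (lo : ℤ)}
    {x : Site 2 | x ∈ (Finset.Icc ![(a : ℤ), (lo : ℤ)] ![(b : ℤ), (hi : ℤ)] : Finset (Site 2)) ∧ x 1 = (hi : ℤ)} :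
    Set (BondConfig (Site 2)))

local notation3 "annulusCross[" c ", " N ", " R "]" =>
  (openCrossing
    (↑(Finset.Icc ![(c : Site 2) 0 - ((R : ℕ) : ℤ), (c : Site 2) 1 - ((R : ℕ) : ℤ)]
        ![(c : Site 2) 0 + ((R : ℕ) : ℤ), (c : Site 2) 1 + ((R : ℕ) : ℤ)] : Finset (Site 2)) : Set (Site 2))
    (↑(Finset.Icc ![(c : Site 2) 0 - ((N : ℕ) : ℤ), (c : Site 2) 1 - ((N : ℕ) : ℤ)]
        ![(c : Site 2) 0 + ((N : ℕ) : ℤ), (c : Site 2) 1 + ((N : ℕ) : ℤ)] : Finset (Site 2)) : Set (Site 2))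
    {x : Site 2 | x ∈ (Finset.Icc ![(c : Site 2) 0 - ((R : ℕ) : ℤ), (c : Site 2) 1 - ((R : ℕ) : ℤ)]
        ![(c : Site 2) 0 + ((R : ℕ) : ℤ), (c : Site 2) 1 + ((R : ℕ) : ℤ)] : Finset (Site 2)) ∧
      (x 0 = (c : Site 2) 0 - ((R : ℕ) : ℤ) ∨ x 0 = (c : Site 2) 0 + ((R : ℕ) : ℤ) ∨
        x 1 = (c : Site 2) 1 - ((R : ℕ) : ℤ) ∨ x 1 = (c : Site 2) 1 + ((R : ℕ) : ℤ))} :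
    Set (BondConfig (Site 2)))

/-- Membership in `rect a b lo hi`. -/
@[simp] theorem mem_rect {a b lo hi : ℤ} {x : Site 2} :
    x ∈ rect[a, b, lo, hi] ↔ a ≤ x 0 ∧ x 0 ≤ b ∧ lo ≤ x 1 ∧ x 1 ≤ hi := by
  simp only [Finset.mem_Icc, Pi.le_def, Fin.forall_fin_two, Matrix.cons_val_zero,
    Matrix.cons_val_one]
  tauto

/-- `hCross` is the open crossing event of a finite region, hence measurable. -/
theorem measurableSet_hCross (a b lo hi : ℤ) : MeasurableSet (hCross[a, b, lo, hi]) :=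
  measurableSet_openCrossing _ _ _

/-- `vCross` is measurable. -/
theorem measurableSet_vCross (a b lo hi : ℤ) : MeasurableSet (vCross[a, b, lo, hi]) :=
  measurableSet_openCrossing _ _ _

/-- The annulus event is measurable. -/
theorem measurableSet_annulusCross (c : Site 2) (N R : ℕ) : MeasurableSet (annulusCross[c, N, R]) :=
  measurableSet_openCrossing _ _ _

/-- The annulus event depends only on the pairs of vertices of the outer box. -/
theorem determinedBy_annulusCross (c : Site 2) (N R : ℕ) :
    DeterminedBy (annulusCross[c, N, R]) ↑(rect[(c 0 - R), (c 0 + R), (c 1 - R), (c 1 + R)]).sym2 :=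
  PlanarDuality.determinedBy_openCrossing _ _ _

/-! ### Identification with the tree's crossing events -/

/-- The box `R(m, n)` of Köhler-Schindler–Tassion is `rect (-m) m (-n) n`. -/
theorem coe_rect_eq_box (m n : ℕ) :
    (↑(rect[(-(m : ℤ)), m, (-(n : ℤ)), n]) : Set (Site 2)) = KST2023.box m n := by
  ext x
  simp only [Finset.mem_coe, mem_rect, KST2023.mem_box, abs_le]
  tauto

/-- `𝓒(m, n)` is the horizontal crossing of `[-m, m] × [-n, n]`. -/
theorem crossing_eq_hCross (m n : ℕ) :
    KST2023.crossing m n = hCross[(-(m : ℤ)), m, (-(n : ℤ)), n] := by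
  rw [KST2023.crossing, ← coe_rect_eq_box]
  rfl

/-- The tree's rectangle `[0, m] × [0, n]` is `rect 0 m 0 n`. -/
theorem rectangle_eq_rect (m n : ℕ) : rectangle m n = rect[0, m, 0, n] := by
  ext x
  simp only [mem_rectangle_iff, mem_rect]

/-- `LR(m, n)` is the horizontal crossing of `[0, m] × [0, n]`. -/
theorem lrCrossing_eq_hCross (m n : ℕ) : lrCrossing m n = hCross[0, m, 0, n] := by
  rw [lrCrossing, leftSide, rightSide, Finset.coe_filter, Finset.coe_filter, rectangle_eq_rect]

/-- The tree's dual rectangle `[0, m - 1] × [-1, n]` is `rect 0 (m - 1) (-1) n`. -/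
theorem dualRectangle_eq_rect (m n : ℕ) : dualRectangle m n = rect[0, ((m : ℤ) - 1), (-1), n] := rfl

/-- `TB*(m, n)` is the `dualConfig`-preimage of the vertical crossing of `[0, m-1] × [-1, n]`. -/
theorem dualTBCrossing_eq (m n : ℕ) :
    dualTBCrossing m n = dualConfig ⁻¹' vCross[0, ((m : ℤ) - 1), (-1), n] := by
  rw [dualTBCrossing, dualTopSide, dualBottomSide, Finset.coe_filter, Finset.coe_filter,
    dualRectangle_eq_rect]
  congr 1
  ext ω
  simp only [mem_openCrossing_iff]
  constructor <;> rintro ⟨x, hx, y, hy, h⟩ <;> exact ⟨y, hy, x, hx, by rwa [openConnIn_comm]⟩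


/-! ### First and last exits of walks -/

section Walks

variable {V : Type*} {G : SimpleGraph V}

/-- **First exit.** A walk from a vertex where `P` fails to a vertex where `P` holds splits as
`w = q ++ (a → b) ++ r` with `P` failing on `q` and holding at `b`. -/
theorem exists_first_sat (P : V → Prop) :
    ∀ {u v : V} (w : G.Walk u v), ¬ P u → P v →
      ∃ (a b : V) (q : G.Walk u a) (h : G.Adj a b) (r : G.Walk b v),
        w = q.append (SimpleGraph.Walk.cons h r) ∧ (∀ t ∈ q.support, ¬ P t) ∧ P b
  | _, _, .nil, hu, hv => (hu hv).elim
  | u, _, .cons (v := x) h w', hu, hv => by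
    by_cases hx : P x
    · exact ⟨u, x, .nil, h, w', rfl, by simpa using hu, hx⟩
    · obtain ⟨a, b, q, h', r, hw, hq, hb⟩ := exists_first_sat P w' hx hv
      refine ⟨a, b, .cons h q, h', r, by rw [hw]; rfl, ?_, hb⟩
      intro t ht
      rw [SimpleGraph.Walk.support_cons, List.mem_cons] at ht
      rcases ht with rfl | ht
      · exact hu
      · exact hq t ht

/-- **Last exit.** A walk from a vertex where `Q` holds to a vertex where `Q` fails splits as
`w = q ++ (a → b) ++ r` with `Q a` and `Q` failing on `r`. -/
theorem exists_last_sat (Q : V → Prop) {u v : V} (w : G.Walk u v) (hu : Q u) (hv : ¬ Q v) :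
    ∃ (a b : V) (q : G.Walk u a) (h : G.Adj a b) (r : G.Walk b v),
      w = q.append (SimpleGraph.Walk.cons h r) ∧ Q a ∧ ∀ t ∈ r.support, ¬ Q t := by
  obtain ⟨a, b, q, h, r, hw, hq, hb⟩ := exists_first_sat Q w.reverse hv hu
  refine ⟨b, a, r.reverse, h.symm, q.reverse, ?_, hb, fun t ht => hq t ?_⟩
  · have h1 := congrArg SimpleGraph.Walk.reverse hw
    rw [SimpleGraph.Walk.reverse_reverse] at h1
    rw [h1, SimpleGraph.Walk.reverse_append, SimpleGraph.Walk.reverse_cons,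
      ← SimpleGraph.Walk.append_assoc]
    rfl
  · rwa [SimpleGraph.Walk.support_reverse, List.mem_reverse] at ht

/-- In a split walk `w = q ++ (a → b) ++ r`, the vertices of the tail `(a → b) ++ r` are vertices of `w`. -/
theorem mem_support_of_mem_support_cons {u v a b : V} {w : G.Walk u v} {q : G.Walk u a}
    {h : G.Adj a b} {r : G.Walk b v} (hw : w = q.append (SimpleGraph.Walk.cons h r)) {t : V}
    (ht : t ∈ (SimpleGraph.Walk.cons h r).support) : t ∈ w.support := by
  rw [hw, SimpleGraph.Walk.mem_support_append_iff]
  exact Or.inr ht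

/-- In a split walk `w = q ++ (a → b) ++ r`, the vertices of the head `q ++ (a → b)` are vertices of `w`. -/
theorem mem_support_of_mem_support_concat {u v a b : V} {w : G.Walk u v} {q : G.Walk u a}
    {h : G.Adj a b} {r : G.Walk b v} (hw : w = q.append (SimpleGraph.Walk.cons h r)) {t : V}
    (ht : t ∈ (q.concat h).support) : t ∈ w.support := by
  rw [hw, SimpleGraph.Walk.mem_support_append_iff]
  rw [SimpleGraph.Walk.support_concat, List.mem_append, List.mem_singleton] at ht
  rcases ht with ht | ht
  · exact Or.inl ht
  · rw [ht, SimpleGraph.Walk.support_cons]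
    exact Or.inr (List.mem_cons_of_mem _ r.start_mem_support)

/-- In a split walk `w = q ++ (a → b) ++ r`, the edges of the tail `(a → b) ++ r` are edges of `w`. -/
theorem mem_edges_of_mem_edges_cons {u v a b : V} {w : G.Walk u v} {q : G.Walk u a}
    {h : G.Adj a b} {r : G.Walk b v} (hw : w = q.append (SimpleGraph.Walk.cons h r))
    {e : Sym2 V} (he : e ∈ (SimpleGraph.Walk.cons h r).edges) : e ∈ w.edges := by
  rw [hw, SimpleGraph.Walk.edges_append]
  exact List.mem_append_right _ he

/-- In a split walk `w = q ++ (a → b) ++ r`, the edges of the head `q ++ (a → b)` are edges of `w`. -/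
theorem mem_edges_of_mem_edges_concat {u v a b : V} {w : G.Walk u v} {q : G.Walk u a}
    {h : G.Adj a b} {r : G.Walk b v} (hw : w = q.append (SimpleGraph.Walk.cons h r))
    {e : Sym2 V} (he : e ∈ (q.concat h).edges) : e ∈ w.edges := by
  rw [hw, SimpleGraph.Walk.edges_append, SimpleGraph.Walk.edges_cons]
  rw [SimpleGraph.Walk.edges_concat, List.concat_eq_append, List.mem_append,
    List.mem_singleton] at he
  rcases he with he | rfl
  · exact List.mem_append_left _ he
  · exact List.mem_append_right _ (List.mem_cons.2 (Or.inl rfl))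

end Walks

/-! ### Lattice walks on `ℤ²`: coordinate control -/

/-- Unit steps of `ℤ²` change each coordinate by at most one. -/
theorem sub_le_one_of_adj {x y : Site 2} (h : (zdGraph 2).Adj x y) (i : Fin 2) :
    y i - x i ≤ 1 ∧ x i - y i ≤ 1 := by
  rcases (zdGraph_two_adj_iff x y).1 h with ⟨h0, h1⟩ | ⟨h0, h1⟩ | ⟨h1, h0⟩ | ⟨h1, h0⟩ <;>
    fin_cases i <;> simp only [Fin.zero_eta, Fin.mk_one] <;> omega

/-- **Tail after the last low vertex.** If `f` increases by at most one along edges, a walk from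
`{f ≤ n}` to `{n < f}` contains a terminal sub-walk starting on the level set `{f = n}` and
staying in `{n ≤ f}`. -/
theorem exists_tail_walk (f : Site 2 → ℤ) (hf : ∀ x y, (zdGraph 2).Adj x y → f y ≤ f x + 1)
    {s e : Site 2} (w : (zdGraph 2).Walk s e) {n : ℤ} (hs : f s ≤ n) (he : n < f e) :
    ∃ (a : Site 2) (p : (zdGraph 2).Walk a e), f a = n ∧
      (∀ t ∈ p.support, n ≤ f t ∧ t ∈ w.support) ∧ ∀ x ∈ p.edges, x ∈ w.edges := by
  obtain ⟨a, b, q, h, r, hw, hQa, hr⟩ := exists_last_sat (fun t => f t ≤ n) w hs (not_le.2 he)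
  have hb : ¬ f b ≤ n := hr b r.start_mem_support
  have hab := hf a b h
  refine ⟨a, SimpleGraph.Walk.cons h r, by omega, fun t ht => ⟨?_, mem_support_of_mem_support_cons hw ht⟩,
    fun x hx => mem_edges_of_mem_edges_cons hw hx⟩
  rw [SimpleGraph.Walk.support_cons, List.mem_cons] at ht
  rcases ht with rfl | ht
  · omega
  · have := hr t ht
    omega

/-- **Head before the first high vertex.** If `f` increases by at most one along edges, a walk
from `{f ≤ n}` to `{n ≤ f}` contains an initial sub-walk ending on the level set `{f = n}` and
staying in `{f ≤ n}`. -/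
theorem exists_head_walk (f : Site 2 → ℤ) (hf : ∀ x y, (zdGraph 2).Adj x y → f y ≤ f x + 1)
    {s e : Site 2} (w : (zdGraph 2).Walk s e) {n : ℤ} (hs : f s ≤ n) (he : n ≤ f e) :
    ∃ (b : Site 2) (p : (zdGraph 2).Walk s b), f b = n ∧
      (∀ t ∈ p.support, f t ≤ n ∧ t ∈ w.support) ∧ ∀ x ∈ p.edges, x ∈ w.edges := by
  by_cases hsn : n ≤ f s
  · refine ⟨s, SimpleGraph.Walk.nil, le_antisymm hs hsn, fun t ht => ?_, fun x hx => by simp at hx⟩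
    rw [SimpleGraph.Walk.support_nil, List.mem_singleton] at ht
    subst ht
    exact ⟨hs, w.start_mem_support⟩
  · obtain ⟨a, b, q, h, r, hw, hq, hPb⟩ := exists_first_sat (fun t => n ≤ f t) w hsn he
    have ha : ¬ n ≤ f a := hq a q.end_mem_support
    have hab := hf a b h
    refine ⟨b, q.concat h, by omega, fun t ht => ⟨?_, mem_support_of_mem_support_concat hw ht⟩,
      fun x hx => mem_edges_of_mem_edges_concat hw hx⟩
    rw [SimpleGraph.Walk.support_concat, List.mem_append, List.mem_singleton] at ht
    rcases ht with ht | rfl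
    · have := hq t ht
      omega
    · omega

/-! ### The annulus event from an open walk -/

/-- **An open walk leaving the box produces the annulus event.** For a configuration `ω`, an
`ω`-open lattice walk from the box `c + [-N, N]²` to a vertex at sup-distance `≥ R ≥ N` from `c`
shows `ω ∈ A(c; N, R)` (stop the walk at its first exit from the open box `c + (-R, R)²`). -/
theorem mem_annulusCross_of_walk {ω : BondConfig (Site 2)} {c : Site 2} {N R : ℕ} {s e : Site 2}
    (w : (zdGraph 2).Walk s e) (hω : ∀ x ∈ w.edges, x ∈ ω)
    (hs : s ∈ rect[(c 0 - N), (c 0 + N), (c 1 - N), (c 1 + N)]) (hNR : N ≤ R)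
    (he : (R : ℤ) ≤ |e 0 - c 0| ∨ (R : ℤ) ≤ |e 1 - c 1|) :
    ω ∈ annulusCross[c, N, R] := by
  rw [mem_rect] at hs
  have hNR' : (N : ℤ) ≤ R := by exact_mod_cast hNR
  by_cases hPs : (R : ℤ) ≤ |s 0 - c 0| ∨ (R : ℤ) ≤ |s 1 - c 1|
  · -- `s` itself lies on the boundary of the outer box
    rw [le_abs', le_abs'] at hPs
    have hsR : s ∈ rect[(c 0 - R), (c 0 + R), (c 1 - R), (c 1 + R)] := by
      rw [mem_rect]; omega
    refine ⟨s, Finset.mem_coe.2 (mem_rect.2 hs), s, ⟨hsR, by omega⟩,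
      openConnIn_refl (Finset.mem_coe.2 hsR)⟩
  · obtain ⟨a, b, q, h, r, hw, hq, hb⟩ :=
      exists_first_sat (fun t : Site 2 => (R : ℤ) ≤ |t 0 - c 0| ∨ (R : ℤ) ≤ |t 1 - c 1|) w hPs he
    have ha : ¬ ((R : ℤ) ≤ |a 0 - c 0| ∨ (R : ℤ) ≤ |a 1 - c 1|) := hq a q.end_mem_support
    simp only [not_or, not_le, abs_lt] at ha
    have h0 := sub_le_one_of_adj h 0
    have h1 := sub_le_one_of_adj h 1
    have hb' := hb
    rw [le_abs', le_abs'] at hb'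
    have hbR : b ∈ rect[(c 0 - R), (c 0 + R), (c 1 - R), (c 1 + R)] := by
      rw [mem_rect]; omega
    have hbsph : b 0 = c 0 - R ∨ b 0 = c 0 + R ∨ b 1 = c 1 - R ∨ b 1 = c 1 + R := by omega
    have hsupp : ∀ t ∈ (q.concat h).support,
        t ∈ (↑(rect[(c 0 - R), (c 0 + R), (c 1 - R), (c 1 + R)]) : Set (Site 2)) := by
      intro t ht
      rw [SimpleGraph.Walk.support_concat, List.mem_append, List.mem_singleton] at ht
      rcases ht with ht | rfl
      · have := hq t ht
        simp only [not_or, not_le, abs_lt] at this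
        exact Finset.mem_coe.2 (mem_rect.2 (by omega))
      · exact Finset.mem_coe.2 hbR
    exact ⟨s, Finset.mem_coe.2 (mem_rect.2 hs), b, ⟨hbR, hbsph⟩,
      mem_openConnIn_of_walk _ hsupp fun x hx => hω x (mem_edges_of_mem_edges_concat hw hx)⟩

/-- **The annulus event is decreasing in the outer radius** (on lattice configurations). -/
theorem annulusCross_anti {ω : BondConfig (Site 2)} (hω : ω ⊆ (zdGraph 2).edgeSet) {c : Site 2}
    {N R R' : ℕ} (hNR : N ≤ R) (hRR' : R ≤ R') (h : ω ∈ annulusCross[c, N, R']) :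
    ω ∈ annulusCross[c, N, R] := by
  obtain ⟨s, hs, e, ⟨-, hesph⟩, hconn⟩ := h
  obtain ⟨w, -, hwω⟩ := exists_walk_of_mem_openConnIn hω hconn
  refine mem_annulusCross_of_walk w hwω (Finset.mem_coe.1 hs) hNR ?_
  have : (R : ℤ) ≤ R' := by exact_mod_cast hRR'
  rw [le_abs', le_abs']
  omega

/-- **Headline of this support file** (registered sub-stub `stub_finiteSizeCriteria_geometry` of
`stub_finiteSizeCriteria`): the first-exit decomposition of a lattice walk of `ℤ²` at its first vertex satisfying `P` (`exists_first_sat`). -/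
theorem stub_finiteSizeCriteria_geometry :
    ∀ (P : Site 2 → Prop) (u v : Site 2) (w : (zdGraph 2).Walk u v), ¬ P u → P v → ∃ (a b : Site 2) (q : (zdGraph 2).Walk u a) (h : (zdGraph 2).Adj a b) (r : (zdGraph 2).Walk b v), w = q.append (SimpleGraph.Walk.cons h r) ∧ (∀ t ∈ q.support, ¬ P t) ∧ P b :=
  fun P _ _ w hu hv => exists_first_sat P w hu hv

end FSC

end Summit.CriticalPhenomena.CardyFormulaZ2.Cruxes.CriticalPathRSW.FiniteSizeEnvelope
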